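import Summits.BirchSwinnertonDyer.BirchSwinnertonDyer.Theorems.ByReductionTypeAtTwoRankOneAtTwoOffBigImageOddLocalGlue
import Summits.BirchSwinnertonDyer.BirchSwinnertonDyer.Theorems.ByReductionTypeAtTwoRankOneAtTwoOffBigImageOddLocalSignAtlas
import HarnessLib

/-!
# Route `ByReductionTypeAtTwo`, crux `RankOneAtTwoOffBigImageOddLocal` (stmt-BirchSwinnertonDyer-23716), line
# `refined_kolyvagin_tamagawa_shift_at_two`: CELLS × FILTERS — the per-cell S₃-locus glue and the atlases (PROVED)

Lead prover `prover-cruxlead-stmt-BirchSwinnertonDyer-23716-g0` (2026-08-28).  §0′/§3″/§3⁗ of the registered skeleton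
`Cruxes/RankOneAtTwoOffBigImageOddLocal/Lines/refined_kolyvagin_tamagawa_shift_at_two.lean` (g7), over `…OffBigImageOddLocalDefs.lean` (p643983),
`…Glue.lean` and `…SignAtlas.lean` (p644173), as a `--supports` helper of the crux.  The line's stubs enter only as HYPOTHESES by importable name.

* RZB habitat: `inRZBList_iff_not_surjective` — on {`E(ℚ)[2] = 0`}, «`ρ_{W,2^∞}` not onto» ⟺ `InRZBListAtTwo W`.
* Filters: `sharp_exact` (at a sharp prime `v₂(a_ℓ) = M(ℓ)` exactly), `sharpRegular_le_regular`.
* The lattice of the cell-indexed K2/K3 statements: `…WithOn_iff_with_univ`, `stringentWithOn_mono` (finer filter / larger cell ⇒ stronger),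
  `structureWithOn_anti` (finer filter / smaller cell ⇒ weaker), restrictions `…_of_with`, and from the REGISTERED (`Φ = ⊤`, cell-free) stubs:
  `stringentWithOn_top_of_modTwo`, `structureWithOn_of_modTwo`.
* `bsdp_two_S3locusWithOn Φ Ω` — PER-CELL glue: PRINT, Σ-accumulation, K2(Φ, Ω), K3(Φ, Ω), rank-`0` `BSD₂` ⟹ `BSD₂(W)` for non-CM `W` with `ρ̄_{W,2}` onto,
  `Ω W`, analytic rank `1`; `bsdp_two_S3locus_of_atlas` (any finite cover by (Φᵢ, Ωᵢ) charts), `bsdp_two_S3locus_twoCells Φ` ({γ₂c ↦ ⊤, off γ₂c ↦ Φ}),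
  the SIGN cells (`onDeltaPlus_of_pos_of_offGamma2c` = the landed δ⁺ cover lemma, `threeCells_cover`), `bsdp_two_S3locus_threeCells Φ₋ Φ₊`
  ({Δ<0 ↦ Φ₋, δ⁺ ↦ Φ₊, γ₂c ↦ ⊤}), `bsdp_two_S3locus_of_mixedAtlas` (finitely many K-side charts + finitely many E-side sockets `EChartAtTwo Θⱼ` under any
  cover); the registered `Φ = ⊤` stubs feed every atlas through `stringentWithOn_top_of_modTwo` / `structureWithOn_of_modTwo`.

Why cells are necessary: the cell-free filtered K2 `StringentPrimitivityModTwoWith Φ` is FALSE for a level-bounded filter (on γ₂c regular Kolyvagin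
primes exist only at levels ≤ 2 while σ is unbounded in the datum), so the filtered programme (cards `regular-frobenius-kolyvagin-primes-pos-disc`,
`sharp-kolyvagin-primes-at-two`) is typed on cells avoiding γ₂c and glued to the numerical (`⊤`) pair on γ₂c by these covers.
BSD is not proved by this; the crux is not proved by this (its seven registered stubs are untouched, 0 closed).

References: [GrossLMS1991] §§2–4; [McCallumLMS1991] §5; [Jetchev2008] (1.3); [WZhang2014] Notations (xii), §3.7; [DokchitserDokchitserMathZ2012];
[RouseZureickbrown2015] §3.
-/

set_option linter.dupNamespace false -- tree convention: `Summit.BirchSwinnertonDyer.BirchSwinnertonDyer.Theorems` (summit = sub-problem)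
set_option autoImplicit false
noncomputable section

open scoped Classical

namespace Summit.BirchSwinnertonDyer.BirchSwinnertonDyer.Theorems.OffBigImageOddLocalAtTwo

open WeierstrassCurve NumberField IsDedekindDomain Rat.HeightOneSpectrum Literature.NumberTheory.EllipticCurves
  Literature.NumberTheory.EllipticCurves.ModularForms
  Literature.NumberTheory.EllipticCurves.Rank1Residual
  Literature.NumberTheory.EllipticCurves.Rank1Residual.Typed
  Literature.NumberTheory.EllipticCurves.KrizLi2019
  Summit.BirchSwinnertonDyer.Rank1Residual
  Summit.BirchSwinnertonDyer.Rank1Residual.AdditivePotMult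
  Summit.BirchSwinnertonDyer.Rank1Residual.F1Sign2
  Summit.BirchSwinnertonDyer.Rank1Residual.F1Sign2.TranspositionDoor
  Summit.BirchSwinnertonDyer.BirchSwinnertonDyer.Theorems.RankOneAtTwoOneDoor
  Summit.BirchSwinnertonDyer.BirchSwinnertonDyer.Theorems.CMExactDescent

/-- Off the surjective `2`-adic locus with `E(ℚ)[2] = 0` ⇒ one of the five Dokchitser–Dokchitser / RZB families: the tree theorem
`not_forall_hasSurjectiveModNGaloisRep_two_pow_iff` with its (β) branch (a rational point of order `2`) excluded by
`NoRationalTwoTorsion` (`EggDoubling.eq_zero_of_two_smul_eq_zero`). [cite: DokchitserDokchitserMathZ2012, Theorem (1)–(3)]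
[cite: RouseZureickbrown2015, §3 Lemma and §1] -/
theorem inRZBList_of_not_surjective (W : WeierstrassCurve ℚ) [W.IsElliptic] (hT : NoRationalTwoTorsion W)
    (hns : ¬ ∀ n : ℕ, W.HasSurjectiveModNGaloisRep ((2 ^ n : ℕ) : ℤ)) : InRZBListAtTwo W := by
  rcases (not_forall_hasSurjectiveModNGaloisRep_two_pow_iff W).mp hns with ⟨P, hP0, h2P⟩ | h
  · exact absurd (EggDoubling.eq_zero_of_two_smul_eq_zero W hT P h2P) hP0
  · exact h

/-- Each RZB family is off the surjective `2`-adic locus (any model, no torsion hypothesis). -/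
theorem not_surjective_of_inRZBList (W : WeierstrassCurve ℚ) [W.IsElliptic] (h : InRZBListAtTwo W) :
    ¬ ∀ n : ℕ, W.HasSurjectiveModNGaloisRep ((2 ^ n : ℕ) : ℤ) :=
  (not_forall_hasSurjectiveModNGaloisRep_two_pow_iff W).mpr (Or.inr h)

/-- **γ is a finite list**: on {`E(ℚ)[2] = 0`}, «`ρ_{W,2^∞}` not onto» ⟺ `InRZBListAtTwo W`. -/
theorem inRZBList_iff_not_surjective (W : WeierstrassCurve ℚ) [W.IsElliptic] (hT : NoRationalTwoTorsion W) :
    InRZBListAtTwo W ↔ ¬ ∀ n : ℕ, W.HasSurjectiveModNGaloisRep ((2 ^ n : ℕ) : ℤ) :=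
  ⟨not_surjective_of_inRZBList W, inRZBList_of_not_surjective W hT⟩

/-- `SharpAtTwo` unfolded under the minimal structure in scope. -/
theorem sharpAtTwo_iff (W : WeierstrassCurve ℚ) [W.IsGloballyMinimal] (ℓ : ℕ) :
    SharpAtTwo W ℓ ↔ 2 ^ (Zhang2014.kolyvaginIndex W 2 ℓ + 1) ∣ ℓ + 1 :=
  ⟨fun h => h, fun h _ => h⟩

/-- **At a sharp prime `v₂(a_ℓ) = M(ℓ)` EXACTLY** (`2^{M(ℓ)} ∣ a_ℓ`, `2^{M(ℓ)+1} ∤ a_ℓ`): the level-free filter is card #8's `IsSharpAtTwo W (M ℓ) ℓ`.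
[cite: WZhang2014, Notations (xii)] -/
theorem sharp_exact (W : WeierstrassCurve ℚ) [W.IsGloballyMinimal] {ℓ : ℕ} (h : SharpAtTwo W ℓ) :
    2 ^ (Zhang2014.kolyvaginIndex W 2 ℓ + 1) ∣ ℓ + 1 ∧
      (2 : ℤ) ^ Zhang2014.kolyvaginIndex W 2 ℓ ∣ W.frobeniusTrace ℓ ∧
      ¬ (2 : ℤ) ^ (Zhang2014.kolyvaginIndex W 2 ℓ + 1) ∣ W.frobeniusTrace ℓ := by
  haveI : Fact (Nat.Prime 2) := ⟨Nat.prime_two⟩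
  have h1 : 2 ^ (Zhang2014.kolyvaginIndex W 2 ℓ + 1) ∣ ℓ + 1 := (sharpAtTwo_iff W ℓ).mp h
  refine ⟨h1, ?_, ?_⟩
  · have := (Zhang2014.le_kolyvaginIndex_iff (W := W) (p := 2) (M := Zhang2014.kolyvaginIndex W 2 ℓ) (ℓ := ℓ)).mp le_rfl
    exact_mod_cast this.2
  · intro h2
    have hle : Zhang2014.kolyvaginIndex W 2 ℓ + 1 ≤ Zhang2014.kolyvaginIndex W 2 ℓ :=
      (Zhang2014.le_kolyvaginIndex_iff (W := W) (p := 2)).mpr ⟨h1, by exact_mod_cast h2⟩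
    omega

/-- The sharp-regular filter refines the regular one (for `stringentWithOn_mono` / `structureWithOn_anti`). -/
theorem sharpRegular_le_regular (W : WeierstrassCurve ℚ) (ℓ : ℕ) (h : SharpRegularAtTwo W ℓ) : RegularAtTwo W ℓ :=
  h.2

/-- γ₂c is inside the RZB list (so off the surjective `2`-adic locus: `not_surjective_of_inRZBList`). -/
theorem inRZBList_of_onGamma2c (W : WeierstrassCurve ℚ) [W.IsElliptic] (h : OnGamma2c W) : InRZBListAtTwo W :=
  Or.inr (Or.inr (Or.inr (Or.inl h)))

/-- δ⁺ lies off γ₂c. -/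
theorem offGamma2c_of_onDeltaPlus (W : WeierstrassCurve ℚ) [W.IsElliptic] (h : OnDeltaPlus W) : OffGamma2c W :=
  fun hc => not_surjective_of_inRZBList W (inRZBList_of_onGamma2c W hc) h.2

/-- The g2 filtered K2 is the cell-`⊤` instance of the g3 one. -/
theorem stringentWithOn_iff_with_univ (Φ : WeierstrassCurve ℚ → ℕ → Prop) :
    StringentPrimitivityModTwoWithOn Φ (fun _ => True) ↔ StringentPrimitivityModTwoWith Φ := by
  constructor
  · intro h W _ _ _ hCM hρ hr K _ _ hK hodd h3 hH hsq1 hsq2 Dt β ι d₁ hy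
    exact h W hCM hρ trivial hr K hK hodd h3 hH hsq1 hsq2 Dt β ι d₁ hy
  · intro h W _ _ _ hCM hρ _ hr K _ _ hK hodd h3 hH hsq1 hsq2 Dt β ι d₁ hy
    exact h W hCM hρ hr K hK hodd h3 hH hsq1 hsq2 Dt β ι d₁ hy

/-- The g2 filtered K3 is the cell-`⊤` instance of the g3 one. -/
theorem structureWithOn_iff_with_univ (Φ : WeierstrassCurve ℚ → ℕ → Prop) :
    ShiftedKolyvaginStructureModTwoWithOn Φ (fun _ => True) ↔ ShiftedKolyvaginStructureModTwoWith Φ := by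
  constructor
  · intro h W _ _ _ hCM hρ K _ _ hK hodd h3 hH hsq1 hsq2 Dt β ι d₁ hy M₀ hdiv hndiv hacc n d hn hKoly hlev hPn
    exact h W hCM hρ trivial K hK hodd h3 hH hsq1 hsq2 Dt β ι d₁ hy M₀ hdiv hndiv hacc n d hn hKoly hlev hPn
  · intro h W _ _ _ hCM hρ _ K _ _ hK hodd h3 hH hsq1 hsq2 Dt β ι d₁ hy M₀ hdiv hndiv hacc n d hn hKoly hlev hPn
    exact h W hCM hρ K hK hodd h3 hH hsq1 hsq2 Dt β ι d₁ hy M₀ hdiv hndiv hacc n d hn hKoly hlev hPn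

/-- **Monotonicity of K2(Φ, Ω)**: a FINER filter and a LARGER cell give a STRONGER statement. -/
theorem stringentWithOn_mono {Φ Ψ : WeierstrassCurve ℚ → ℕ → Prop} {Ω Ω' : WeierstrassCurve ℚ → Prop}
    (hΦ : ∀ W ℓ, Φ W ℓ → Ψ W ℓ) (hΩ : ∀ W, Ω' W → Ω W)
    (h : StringentPrimitivityModTwoWithOn Φ Ω) : StringentPrimitivityModTwoWithOn Ψ Ω' := by
  intro W _ _ _ hCM hρ hW hr K _ _ hK hodd h3 hH hsq1 hsq2 Dt β ι d₁ hy
  obtain ⟨n, d, hn, hKoly, hlev, hPn⟩ := h W hCM hρ (hΩ W hW) hr K hK hodd h3 hH hsq1 hsq2 Dt β ι d₁ hy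
  exact ⟨n, d, hn, fun ℓ hℓ => ⟨(hKoly ℓ hℓ).1, hΦ W ℓ (hKoly ℓ hℓ).2⟩, hlev, hPn⟩

/-- **Antitonicity of K3(Φ, Ω)**: a FINER filter and a SMALLER cell give a WEAKER statement. -/
theorem structureWithOn_anti {Φ Ψ : WeierstrassCurve ℚ → ℕ → Prop} {Ω Ω' : WeierstrassCurve ℚ → Prop}
    (hΦ : ∀ W ℓ, Φ W ℓ → Ψ W ℓ) (hΩ : ∀ W, Ω' W → Ω W)
    (h : ShiftedKolyvaginStructureModTwoWithOn Ψ Ω) : ShiftedKolyvaginStructureModTwoWithOn Φ Ω' := by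
  intro W _ _ _ hCM hρ hW K _ _ hK hodd h3 hH hsq1 hsq2 Dt β ι d₁ hy M₀ hdiv hndiv hacc n d hn hKoly hlev hPn
  exact h W hCM hρ (hΩ W hW) K hK hodd h3 hH hsq1 hsq2 Dt β ι d₁ hy M₀ hdiv hndiv hacc n d hn
    (fun ℓ hℓ => ⟨(hKoly ℓ hℓ).1, hΦ W ℓ (hKoly ℓ hℓ).2⟩) hlev hPn

/-- Restriction of the g2 filtered K2 to any cell. -/
theorem stringentWithOn_of_with (Φ : WeierstrassCurve ℚ → ℕ → Prop) (Ω : WeierstrassCurve ℚ → Prop)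
    (h : StringentPrimitivityModTwoWith Φ) : StringentPrimitivityModTwoWithOn Φ Ω :=
  stringentWithOn_mono (fun _ _ hφ => hφ) (fun _ _ => trivial) ((stringentWithOn_iff_with_univ Φ).mpr h)

/-- Restriction of the g2 filtered K3 to any cell. -/
theorem structureWithOn_of_with (Φ : WeierstrassCurve ℚ → ℕ → Prop) (Ω : WeierstrassCurve ℚ → Prop)
    (h : ShiftedKolyvaginStructureModTwoWith Φ) : ShiftedKolyvaginStructureModTwoWithOn Φ Ω :=
  structureWithOn_anti (fun _ _ hφ => hφ) (fun _ _ => trivial) ((structureWithOn_iff_with_univ Φ).mpr h)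

/-- **The REGISTERED K2 (`Φ = ⊤`, no cell) gives the cell-`Ω`, filter-`⊤` instance for every `Ω`.** -/
theorem stringentWithOn_top_of_modTwo (Ω : WeierstrassCurve ℚ → Prop) (h : StringentPrimitivityModTwoAtTwo) :
    StringentPrimitivityModTwoWithOn (fun _ _ => True) Ω :=
  stringentWithOn_of_with _ Ω (stringentWith_top_of_modTwo h)

/-- **The REGISTERED K3 (`Φ = ⊤`, no cell) gives EVERY cell × filter instance.** -/
theorem structureWithOn_of_modTwo (Φ : WeierstrassCurve ℚ → ℕ → Prop) (Ω : WeierstrassCurve ℚ → Prop)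
    (h : ShiftedKolyvaginStructureModTwoAtTwo) : ShiftedKolyvaginStructureModTwoWithOn Φ Ω :=
  structureWithOn_of_with Φ Ω (structureWith_of_modTwo Φ h)

/-- **S₃-locus glue PER CELL, with a witness filter** (g3): PRINT, K1, K2(Φ, Ω), K3(Φ, Ω), rank-`0` `BSD₂` of non-CM curves ⟹ `BSD₂(W)` for `W`
non-CM with `ρ̄_{W,2}` onto, `W ∈ Ω`, analytic rank `1`.  The body is `bsdp_two_S3locusWith`'s VERBATIM with the cell hypothesis `hΩ` threaded into
the two filtered stubs (the door, the datum, `y_K`, `M₀`, `σ ≤ M₀`, the twin and the shifted exact descent never look at `Φ` or `Ω`).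
[cite: GrossLMS1991, §2 Conj. (2.2), §§3–4] [cite: McCallumLMS1991, §5] [cite: Jetchev2008, p. 3 Hyp., (1.3)] -/
theorem bsdp_two_S3locusWithOn (Φ : WeierstrassCurve ℚ → ℕ → Prop) (Ω : WeierstrassCurve ℚ → Prop)
    (hpub : S_pub) (hHL : S_pubHL) (hMilneC : Milne1972.bsdQuotient_baseChange_quadratic_anyModel)
    (hK1 : SigmaAccumulationModTwoAtTwo) (hK2 : StringentPrimitivityModTwoWithOn Φ Ω)
    (hK3 : ShiftedKolyvaginStructureModTwoWithOn Φ Ω)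
    (hZ : S_rankZeroTwin)
    (W : WeierstrassCurve ℚ) [W.IsElliptic] [W.IsGloballyMinimal] (hCM : ¬ W.HasCM)
    (hρ2 : W.HasSurjectiveModNGaloisRep 2) (hΩ : Ω W) (hr : W.analyticRank = 1) : BSDp W 2 := by
  haveI : Fact (Nat.Prime 2) := ⟨Nat.prime_two⟩
  haveI hN : NeZero (W.conductorNorm ℤ) := ⟨(W.conductorNorm_pos_holds).ne'⟩
  have hnf : exists_isNewformOf := hHL.1
  have hmod : hasEntireLFunction_rat := hpub.2.2
  have hGZK : rank_eq_analyticRank_of_analyticRank_le_one := hpub.2.1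
  -- the Kolyvagin-admissible door
  obtain ⟨K, _iF, _iN, hK, hodd, h3, hH, hsq1, hsq2, -, hLt, -⟩ :=
    exists_kolyvaginDoorField_of_analyticRank_eq_one hnf hHL.2 W hr
  -- ANY datum, the orientation, the embedding, the conductor-`1` datum
  obtain ⟨Dt⟩ := (nonempty_modularParametrizationData_iff_exists_isNewformOf_unconditional.mpr hnf) W
  obtain ⟨β, hβ⟩ : ∃ β : ℤ, (4 * (W.conductorNorm ℤ : ℕ) : ℤ) ∣ β ^ 2 - NumberField.discr K :=
    Literature.NumberTheory.QuadraticFields.Quadratic.exists_dvd_sq_sub_discr_of_ncard_primesOver hK.1 (NeZero.ne _) hH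
  obtain ⟨ι⟩ : Nonempty (K →+* ℂ) := inferInstance
  obtain ⟨d₁⟩ := exists_kolyvaginHeegnerData_one
    (phi_heegnerTau_mem_singularModuliField_holds (W.conductorNorm ℤ) W K) hK Dt β ι hβ
  -- `y_K` has infinite order: `L'(W/K, 1) = L'(W, 1) · L(W^{(d_K)}, 1) ≠ 0` and Gross–Zagier
  haveI hEK : (W.baseChange K).IsElliptic := isElliptic_baseChange' W K
  have hL0 : W.entireLFunction 1 = 0 := entireLFunction_one_eq_zero_of_analyticRank_eq_one hr
  obtain ⟨-, hderiv⟩ := leadingLCoeff_eq_deriv_of_analyticRank_eq_one hr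
  have hLK : LDerivEK W K ≠ 0 := by
    rw [lDerivEK_eq_deriv_mul W K hmod hL0]; exact mul_ne_zero hderiv hLt
  obtain ⟨hGZ, -, -⟩ := hpub.1 (W.conductorNorm ℤ) W K
  obtain ⟨P₀, Hd, hP₀, hP₀K⟩ := exists_heegnerPoint_map_eq_derivedPoint_one hK hH d₁
  have hP₀inf : ¬ IsOfFinAddOrder P₀ :=
    (lDerivEK_ne_zero_iff_not_isOfFinAddOrder W (W.conductorNorm ℤ) K hGZ hK hH ⟨Dt, Hd, ι, hP₀⟩).mp hLK
  have hy : ¬ IsOfFinAddOrder d₁.derivedPoint := by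
    intro hfin
    apply hP₀inf
    rw [← hP₀K] at hfin
    exact (WeierstrassCurve.Affine.Point.map_injective (W' := W) _).isOfFinAddOrder_iff.mp hfin
  -- `M₀ = ord₂(y_K)` in `E(K[1])` (a number field: finite generation)
  obtain ⟨M₀, hdiv, hndiv⟩ : ∃ M₀ : ℕ,
      (∃ Q : (W.baseChange (ringClassField K ι 1)).toAffine.Point, ((2 ^ M₀ : ℕ) : ℤ) • Q = d₁.derivedPoint) ∧
      ¬ ∃ Q : (W.baseChange (ringClassField K ι 1)).toAffine.Point, ((2 ^ (M₀ + 1) : ℕ) : ℤ) • Q = d₁.derivedPoint := by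
    haveI : NumberField (ringClassField K ι 1) := numberField_ringClassField hK ι one_ne_zero
    haveI : (W.baseChange (ringClassField K ι 1)).IsElliptic := by rw [baseChange]; infer_instance
    haveI : Module.Finite ℤ (W.baseChange (ringClassField K ι 1)).toAffine.Point := by
      convert (W.baseChange (ringClassField K ι 1)).module_finite_point_holds
    exact exists_pow_smul_eq_and_not_of_not_isOfFinAddOrder Nat.prime_two hy
  -- the three stubs: Σ-accumulation, filtered stringent primitivity, filtered shifted structure theorem
  have hacc := hK1 W hCM hρ2 hr K hK hodd h3 hH hsq1 hsq2 Dt β ι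
  obtain ⟨n, d, hn, hKoly, hlev, hPn⟩ := hK2 W hCM hρ2 hΩ hr K hK hodd h3 hH hsq1 hsq2 Dt β ι d₁ hy
  have hsha : Nat.card (AddCommGroup.primaryComponent (W.baseChange K).sha 2) = 2 ^ (2 * (M₀ - sigmaShift W Dt)) :=
    hK3 W hCM hρ2 hΩ K hK hodd h3 hH hsq1 hsq2 Dt β ι d₁ hy M₀ hdiv hndiv hacc n d hn hKoly hlev hPn
  -- `σ ≤ M₀`: accumulation at `n = 1` (`M(1) = ∞`) against the exactness of `M₀`
  have hσ : sigmaShift W Dt ≤ M₀ := by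
    by_contra hlt
    push Not at hlt
    exact hndiv (hacc 1 d₁ (M₀ + 1) squarefree_one (by simp) (by simp) (by omega))
  -- the twin: a globally minimal model, non-CM, of analytic rank `0`; its `BSD₂` from the rank-`0` statement
  have hD0 : (NumberField.discr K : ℚ) ≠ 0 := by exact_mod_cast NumberField.discr_ne_zero K
  haveI hEt : (W.quadraticTwist (NumberField.discr K : ℚ)).IsElliptic := W.isElliptic_quadraticTwist hD0
  obtain ⟨Cd, hCd⟩ := hasGlobalMinimalModel_rat_holds (W.quadraticTwist (NumberField.discr K : ℚ))
  haveI : (Cd • W.quadraticTwist (NumberField.discr K : ℚ)).IsGloballyMinimal := hCd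
  have hCMd : ¬ (Cd • W.quadraticTwist (NumberField.discr K : ℚ)).HasCM :=
    Summit.BirchSwinnertonDyer.BirchSwinnertonDyer.Theorems.RamifiedPairUpperBound.not_hasCM_of_smul_quadraticTwist_eq hD0 rfl hCM
  have hrt : (W.quadraticTwist (NumberField.discr K : ℚ)).analyticRank = 0 :=
    ((W.quadraticTwist _).analyticRank_eq_zero_iff_holds (hmod _)).mpr hLt
  have hrd : (Cd • W.quadraticTwist (NumberField.discr K : ℚ)).analyticRank = 0 := by
    rw [analyticRank_smul, hrt]
  have hBd : BSDp (Cd • W.quadraticTwist (NumberField.discr K : ℚ)) 2 := hZ _ hCMd hrd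
  exact bsdp_two_of_card_sha_baseChange_eq_shifted_rankOne W K Dt β ι d₁ (Cd • W.quadraticTwist (NumberField.discr K : ℚ))
    hGZ hGZK hmod hMilneC hρ2 hr hK hodd h3 hH hy hdiv hndiv hσ hsha ⟨Cd, rfl⟩ hBd

/-- **Cover lemma (any atlas)**: cells `Ω i` with filters `Φ i`, the filtered pair proved on each, and a cover of the S₃-locus (non-CM, analytic
rank `1`) by the cells ⟹ the `hS₃` hypothesis of the split `offBigImage_of_strataModTwo`.  The lead's finer atlas {δ⁺ ↦ sharp-regular,
`Δ < 0` ↦ regular or `⊤`, γ₂c ↦ `⊤`} is an instance once its cover («`ρ̄₂` onto ∧ `Δ > 0` ∧ `2Δ ∉ ℚ^{×2}` ⇒ `ρ_{2^∞}` onto») is proved.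
[g4: PROVED — `onDeltaPlus_of_pos_of_offGamma2c`; the instance is `bsdp_two_S3locus_threeCells` (§3⁗).] -/
theorem bsdp_two_S3locus_of_atlas {ι : Type*} (Φ : ι → WeierstrassCurve ℚ → ℕ → Prop) (Ω : ι → WeierstrassCurve ℚ → Prop)
    (hpub : S_pub) (hHL : S_pubHL) (hMilneC : Milne1972.bsdQuotient_baseChange_quadratic_anyModel)
    (hK1 : SigmaAccumulationModTwoAtTwo)
    (hK2 : ∀ i, StringentPrimitivityModTwoWithOn (Φ i) (Ω i)) (hK3 : ∀ i, ShiftedKolyvaginStructureModTwoWithOn (Φ i) (Ω i))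
    (hZ : S_rankZeroTwin)
    (hcover : ∀ (W : WeierstrassCurve ℚ) [W.IsElliptic] [W.IsGloballyMinimal], ¬ W.HasCM →
      W.HasSurjectiveModNGaloisRep 2 → W.analyticRank = 1 → ∃ i, Ω i W)
    (W : WeierstrassCurve ℚ) [W.IsElliptic] [W.IsGloballyMinimal] (hCM : ¬ W.HasCM)
    (hρ2 : W.HasSurjectiveModNGaloisRep 2) (hr : W.analyticRank = 1) : BSDp W 2 := by
  obtain ⟨i, hi⟩ := hcover W hCM hρ2 hr
  exact bsdp_two_S3locusWithOn (Φ i) (Ω i) hpub hHL hMilneC hK1 (hK2 i) (hK3 i) hZ W hCM hρ2 hi hr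

/-- **The two-cell atlas** {γ₂c ↦ `Φ = ⊤`, its complement ↦ ANY filter `Φ`} covers the S₃-locus by `by_cases` (PROVED): the shape in which the
regular / sharp-regular filter of cards #7/#8 is SAFE to run (its primes have unbounded level off γ₂c), with γ₂c kept on numerical Kolyvagin primes. -/
theorem bsdp_two_S3locus_twoCells (Φ : WeierstrassCurve ℚ → ℕ → Prop)
    (hpub : S_pub) (hHL : S_pubHL) (hMilneC : Milne1972.bsdQuotient_baseChange_quadratic_anyModel)
    (hK1 : SigmaAccumulationModTwoAtTwo)
    (hK2c : StringentPrimitivityModTwoWithOn (fun _ _ => True) OnGamma2c)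
    (hK3c : ShiftedKolyvaginStructureModTwoWithOn (fun _ _ => True) OnGamma2c)
    (hK2r : StringentPrimitivityModTwoWithOn Φ OffGamma2c) (hK3r : ShiftedKolyvaginStructureModTwoWithOn Φ OffGamma2c)
    (hZ : S_rankZeroTwin)
    (W : WeierstrassCurve ℚ) [W.IsElliptic] [W.IsGloballyMinimal] (hCM : ¬ W.HasCM)
    (hρ2 : W.HasSurjectiveModNGaloisRep 2) (hr : W.analyticRank = 1) : BSDp W 2 := by
  by_cases hc : IsSquare (2 * W.Δ)
  · exact bsdp_two_S3locusWithOn _ _ hpub hHL hMilneC hK1 hK2c hK3c hZ W hCM hρ2 hc hr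
  · exact bsdp_two_S3locusWithOn _ _ hpub hHL hMilneC hK1 hK2r hK3r hZ W hCM hρ2 hc hr

/-- The plain-typed δ⁺ cell is `OnDeltaPlus` under the elliptic structure in scope. -/
theorem onDeltaPlusCell_iff (W : WeierstrassCurve ℚ) [W.IsElliptic] : OnDeltaPlusCell W ↔ OnDeltaPlus W :=
  ⟨fun h => ⟨h.1, fun n => h.2 n⟩, fun h => ⟨h.1, fun n => h.2 n⟩⟩

/-- **THE δ⁺ COVER LEMMA (g3's untyped «γ₂b ⇒ `Δ < 0` ∨ `E(ℚ)[2] ≠ 0`», PROVED)**: on the S₃-locus (`ρ̄_{W,2}` onto), `Δ > 0` off γ₂c ⟹ the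
`2`-adic image is FULL, i.e. `W ∈ δ⁺`.  By the typed complement `not_forall_hasSurjectiveModNGaloisRep_two_pow_iff`: (β) and (γ₁) contradict
`ρ̄₂` onto, (γ₂a), (γ₂b), (γ₂d) force `Δ < 0`, (γ₂c) is excluded by hypothesis. [cite: DokchitserDokchitserMathZ2012, Theorem (1)–(3)]
[cite: RouseZureickbrown2015, §3] -/
theorem onDeltaPlus_of_pos_of_offGamma2c (W : WeierstrassCurve ℚ) [W.IsElliptic] (hρ : W.HasSurjectiveModNGaloisRep 2) (hΔ : 0 < W.Δ)
    (hc : OffGamma2c W) : OnDeltaPlus W :=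
  ⟨hΔ, forall_hasSurjectiveModNGaloisRep_two_pow_of_pos W hρ hΔ hc⟩

/-- δ⁺ ⟹ `ρ̄_{W,2}` onto (δ⁺ is inside the S₃-locus). -/
theorem hasSurjectiveModNGaloisRep_two_of_onDeltaPlus (W : WeierstrassCurve ℚ) [W.IsElliptic] (h : OnDeltaPlus W) :
    W.HasSurjectiveModNGaloisRep 2 := by
  simpa using h.2 1

/-- **The S₃-locus is covered by the three SIGN cells** `Δ < 0`, δ⁺, γ₂c (PROVED cover of the three-cell atlas). -/
theorem threeCells_cover (W : WeierstrassCurve ℚ) [W.IsElliptic] (hρ : W.HasSurjectiveModNGaloisRep 2) :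
    OnDeltaMinus W ∨ OnDeltaPlusCell W ∨ OnGamma2c W := by
  rcases lt_or_lt_iff_ne.mpr W.isUnit_Δ.ne_zero with h | h
  · exact Or.inl h
  · by_cases hc : IsSquare (2 * W.Δ)
    · exact Or.inr (Or.inr hc)
    · exact Or.inr (Or.inl ((onDeltaPlusCell_iff W).mpr (onDeltaPlus_of_pos_of_offGamma2c W hρ h hc)))

/-- δ⁺ (plain-typed) lies off γ₂c — over a bare `W` (the elliptic structure is rebuilt from `Δ > 0`), the form `stringentWithOn_mono` consumes. -/
theorem offGamma2c_of_onDeltaPlusCell (W : WeierstrassCurve ℚ) (h : OnDeltaPlusCell W) : OffGamma2c W := by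
  haveI : W.IsElliptic := ⟨isUnit_iff_ne_zero.mpr h.1.ne'⟩
  exact offGamma2c_of_onDeltaPlus W ((onDeltaPlusCell_iff W).mp h)

/-- `Δ < 0` lies off γ₂c (`2Δ = r²` forces `Δ ≥ 0`). -/
theorem offGamma2c_of_onDeltaMinus (W : WeierstrassCurve ℚ) (h : OnDeltaMinus W) : OffGamma2c W := by
  rintro ⟨r, hr⟩
  have h' : W.Δ < 0 := h
  nlinarith [mul_self_nonneg r]

/-- The `(Φ, OffGamma2c)` K2 restricts to δ⁺. -/
theorem stringentWithOn_deltaPlus_of_offGamma2c (Φ : WeierstrassCurve ℚ → ℕ → Prop) (h : StringentPrimitivityModTwoWithOn Φ OffGamma2c) :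
    StringentPrimitivityModTwoWithOn Φ OnDeltaPlusCell :=
  stringentWithOn_mono (fun _ _ hφ => hφ) (fun W hW => offGamma2c_of_onDeltaPlusCell W hW) h

/-- The `(Φ, OffGamma2c)` K3 restricts to δ⁺. -/
theorem structureWithOn_deltaPlus_of_offGamma2c (Φ : WeierstrassCurve ℚ → ℕ → Prop)
    (h : ShiftedKolyvaginStructureModTwoWithOn Φ OffGamma2c) : ShiftedKolyvaginStructureModTwoWithOn Φ OnDeltaPlusCell :=
  structureWithOn_anti (fun _ _ hφ => hφ) (fun W hW => offGamma2c_of_onDeltaPlusCell W hW) h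

/-- The `(Φ, OffGamma2c)` K2 restricts to `Δ < 0`. -/
theorem stringentWithOn_deltaMinus_of_offGamma2c (Φ : WeierstrassCurve ℚ → ℕ → Prop) (h : StringentPrimitivityModTwoWithOn Φ OffGamma2c) :
    StringentPrimitivityModTwoWithOn Φ OnDeltaMinus :=
  stringentWithOn_mono (fun _ _ hφ => hφ) (fun W hW => offGamma2c_of_onDeltaMinus W hW) h

/-- The `(Φ, OffGamma2c)` K3 restricts to `Δ < 0`. -/
theorem structureWithOn_deltaMinus_of_offGamma2c (Φ : WeierstrassCurve ℚ → ℕ → Prop)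
    (h : ShiftedKolyvaginStructureModTwoWithOn Φ OffGamma2c) : ShiftedKolyvaginStructureModTwoWithOn Φ OnDeltaMinus :=
  structureWithOn_anti (fun _ _ hφ => hφ) (fun W hW => offGamma2c_of_onDeltaMinus W hW) h

/-- **THE THREE-CELL SIGN ATLAS** {`Δ < 0` ↦ `Φ₋`, δ⁺ ↦ `Φ₊`, γ₂c ↦ `⊤`} **with its cover PROVED** (`threeCells_cover`): PRINT, K1, the filtered pair on
each of the three cells, rank-`0` `BSD₂` of non-CM curves ⟹ `BSD₂` on the S₃-locus.  This is the atlas cards #7/#8 asked for: the regular /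
sharp-regular filter runs on δ⁺ (its designed habitat: complex conjugation diagonal, residual 24883's top-bit loss; a regular Frobenius loses nothing,
R1 §3‴), `Δ < 0` takes `⊤` or regular (full supply either way), γ₂c stays numerical (type filters are level-bounded there, §0″). -/
theorem bsdp_two_S3locus_threeCells (Φm Φp : WeierstrassCurve ℚ → ℕ → Prop)
    (hpub : S_pub) (hHL : S_pubHL) (hMilneC : Milne1972.bsdQuotient_baseChange_quadratic_anyModel)
    (hK1 : SigmaAccumulationModTwoAtTwo)
    (hK2m : StringentPrimitivityModTwoWithOn Φm OnDeltaMinus) (hK3m : ShiftedKolyvaginStructureModTwoWithOn Φm OnDeltaMinus)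
    (hK2p : StringentPrimitivityModTwoWithOn Φp OnDeltaPlusCell) (hK3p : ShiftedKolyvaginStructureModTwoWithOn Φp OnDeltaPlusCell)
    (hK2c : StringentPrimitivityModTwoWithOn (fun _ _ => True) OnGamma2c)
    (hK3c : ShiftedKolyvaginStructureModTwoWithOn (fun _ _ => True) OnGamma2c)
    (hZ : S_rankZeroTwin)
    (W : WeierstrassCurve ℚ) [W.IsElliptic] [W.IsGloballyMinimal] (hCM : ¬ W.HasCM)
    (hρ2 : W.HasSurjectiveModNGaloisRep 2) (hr : W.analyticRank = 1) : BSDp W 2 := by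
  rcases threeCells_cover W hρ2 with h | h | h
  · exact bsdp_two_S3locusWithOn _ _ hpub hHL hMilneC hK1 hK2m hK3m hZ W hCM hρ2 h hr
  · exact bsdp_two_S3locusWithOn _ _ hpub hHL hMilneC hK1 hK2p hK3p hZ W hCM hρ2 h hr
  · exact bsdp_two_S3locusWithOn _ _ hpub hHL hMilneC hK1 hK2c hK3c hZ W hCM hρ2 h hr

/-- The two-cell data {γ₂c ↦ `⊤`, off γ₂c ↦ `Φ`} feed the three-cell atlas with `Φ₋ = Φ₊ = Φ` (restriction along `Δ < 0 ⊂` off-γ₂c, δ⁺ `⊂` off-γ₂c):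
the three-cell atlas REFINES the two-cell one (it lets `Φ₋ ≠ Φ₊`). -/
theorem bsdp_two_S3locus_threeCells_of_twoCells (Φ : WeierstrassCurve ℚ → ℕ → Prop)
    (hpub : S_pub) (hHL : S_pubHL) (hMilneC : Milne1972.bsdQuotient_baseChange_quadratic_anyModel)
    (hK1 : SigmaAccumulationModTwoAtTwo)
    (hK2c : StringentPrimitivityModTwoWithOn (fun _ _ => True) OnGamma2c)
    (hK3c : ShiftedKolyvaginStructureModTwoWithOn (fun _ _ => True) OnGamma2c)
    (hK2r : StringentPrimitivityModTwoWithOn Φ OffGamma2c) (hK3r : ShiftedKolyvaginStructureModTwoWithOn Φ OffGamma2c)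
    (hZ : S_rankZeroTwin)
    (W : WeierstrassCurve ℚ) [W.IsElliptic] [W.IsGloballyMinimal] (hCM : ¬ W.HasCM)
    (hρ2 : W.HasSurjectiveModNGaloisRep 2) (hr : W.analyticRank = 1) : BSDp W 2 :=
  bsdp_two_S3locus_threeCells Φ Φ hpub hHL hMilneC hK1 (stringentWithOn_deltaMinus_of_offGamma2c Φ hK2r)
    (structureWithOn_deltaMinus_of_offGamma2c Φ hK3r) (stringentWithOn_deltaPlus_of_offGamma2c Φ hK2r)
    (structureWithOn_deltaPlus_of_offGamma2c Φ hK3r) hK2c hK3c hZ W hCM hρ2 hr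

/-- **MIXED ATLAS GLUE (K-side charts + E-side charts; PROVED)**: K-side charts `(Φ i, Ω i)` (the filtered Kolyvagin pair on the cell), E-side charts
`Θ j` (any instrument in the socket `EChartAtTwo`), PRINT, K1, rank-`0` twins by name, and a cover of the S₃-locus by `⋃ Ω i ∪ ⋃ Θ j` ⟹ `BSD₂` on the
locus.  The shape in which this K-side line and an E-side instrument on a γ₂ sub-face (card #9 on γ₂a) divide the S₃-locus. -/
theorem bsdp_two_S3locus_of_mixedAtlas {ι κ : Type*} (Φ : ι → WeierstrassCurve ℚ → ℕ → Prop) (Ω : ι → WeierstrassCurve ℚ → Prop)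
    (Θ : κ → WeierstrassCurve ℚ → Prop)
    (hpub : S_pub) (hHL : S_pubHL) (hMilneC : Milne1972.bsdQuotient_baseChange_quadratic_anyModel)
    (hK1 : SigmaAccumulationModTwoAtTwo)
    (hK2 : ∀ i, StringentPrimitivityModTwoWithOn (Φ i) (Ω i)) (hK3 : ∀ i, ShiftedKolyvaginStructureModTwoWithOn (Φ i) (Ω i))
    (hE : ∀ j, EChartAtTwo (Θ j)) (hZ : S_rankZeroTwin)
    (hcover : ∀ (W : WeierstrassCurve ℚ) [W.IsElliptic] [W.IsGloballyMinimal], ¬ W.HasCM →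
      W.HasSurjectiveModNGaloisRep 2 → W.analyticRank = 1 → (∃ i, Ω i W) ∨ (∃ j, Θ j W))
    (W : WeierstrassCurve ℚ) [W.IsElliptic] [W.IsGloballyMinimal] (hCM : ¬ W.HasCM)
    (hρ2 : W.HasSurjectiveModNGaloisRep 2) (hr : W.analyticRank = 1) : BSDp W 2 := by
  rcases hcover W hCM hρ2 hr with ⟨i, hi⟩ | ⟨j, hj⟩
  · exact bsdp_two_S3locusWithOn (Φ i) (Ω i) hpub hHL hMilneC hK1 (hK2 i) (hK3 i) hZ W hCM hρ2 hi hr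
  · exact hE j hZ W hCM hρ2 hj hr

end Summit.BirchSwinnertonDyer.BirchSwinnertonDyer.Theorems.OffBigImageOddLocalAtTwo

end
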